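import Summits.ValiantsHypothesis.ValiantsHypothesis.Theorems.BarrierLeverChowBenchmarkPairsKernelPoised
import Summits.ValiantsHypothesis.ValiantsHypothesis.Theorems.BarrierLeverChowBenchmarkPairsPeelRows
import Summits.ValiantsHypothesis.ValiantsHypothesis.Theorems.BarrierLeverPartitionMinorsMooreBenchCertE

/-!
# Route BarrierLever — item 22038 `ChowBenchmarkPairs`, line `moore-peel`: the DIRICHLET(α,α) family of the
# peel — `det G^{(α)}_i` is a NONZERO polynomial in `α` for every `i` (top form = the zeta window `Z_i`), hence
# Dirichlet poisedness at every height for all but finitely many natural parameters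

Helper file (`--supports stmt-ValiantsHypothesis-22038`; cell valiant-natproofs, rung V4, 𝒟-side benchmark of
record, line `moore_peel`, card v12 (E)(iii) «the generic-α corollary»; seat val-np-p4 gen 26).  Closes NO item.
Two auxiliary definitions (`dirichletPeelPoly i`, the stage matrix with symbolic parameter over `ℤ[X]`, and its
rescaling `scaledDirichlet i`).

THE FAMILY.  The segment mean of `z^T` over `[P_a, P_b]` with the Beta(α,α) weight is, up to the column factor
`(2α)^{(|T|)}`, `Σ_{d ⊆ T} α^{(|T∖d|)} α^{(|d|)} P_a^{T∖d} P_b^d` (rising factorials `α^{(k)} = α(α+1)⋯(α+k-1) =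
Nat.ascFactorial α k`): the kernel-weighted rows of `…KernelPeelRows` with `κ = Nat.ascFactorial α`.  `α = 1`
gives the factorial weights of the line's segment-mean stub (`kpeelMatrix_ascFactorial_one : G^{(1)}_i = G_i`),
`α → ∞` (normalised) the unit weights of THEOREM M.

* `dirichletPeelPoly i ∈ Mat_i(ℤ[X])`: `[T_j ⊆ T_{c_i+m}]·X(X+1)⋯(X+k-1)` (`ascPochhammer ℤ k`, `k = |T_{c_i+m}|-|T_j|`);
  `dirichletPeelPoly_eval : G^{(X)}_i(α) = kpeelMatrix (Nat.ascFactorial α) i`, `eval_det_dirichletPeelPoly`.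
* **`det_dirichletPeelPoly_ne_zero : det G^{(X)}_i ≠ 0` in `ℤ[X]` for EVERY `i`** — rescale rows by `X^{|T_j|}` and
  columns by `X^{D-|T_{c_i+m}|}` (`D = c_i + i`): every entry becomes monic of degree `D` or zero, with
  `X^D`-coefficient matrix the zeta window `Z_i` (`coeff_scaledDirichlet`), so a coefficient of
  `X^N · det G^{(X)}_i` equals `det Z_i = ±1` (LEMMA Z′, `…ZetaMinors`; `coeff_det_scaledDirichlet` via
  `ChowBenchmarkPeel.coeff_det_of_natDegree_le`).
* `finite_bad_dirichlet` (for each `i` only finitely many natural `α` kill `det G^{(α)}_i`),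
  `eventually_det_dirichlet_ne_zero` (∀h ∃α₀ ∀α ≥ α₀ ∀ i ≤ h, `det G^{(α)}_i ≠ 0`).
* **`eventually_kernelPoisedAt_dirichlet`** / `kernelPoisedAt_dirichlet_off_finite` — TARGET (iii): for every
  `h`, `KernelPoisedAt (Nat.ascFactorial α) h` for all natural `α` outside a finite set (THEOREM A^κ,
  `…KernelPoised`).  What is generic (every α but finitely many) and what is arithmetic (`α = 1`, where
  `det G_183 = 0`) is thereby stated exactly; `kernelPoisedAt_factorial_of_le_52` records `α = 1` inside its
  certified window (`det G_i ≠ 0`, `i ≤ 52`, `…MooreBenchCertE`): segment mean-value poisedness for `h ≤ 52`.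

WHAT THIS IS NOT: nothing at the parameter `α = 1` beyond the certified window — the segment-mean stub
`stub_segmentMeanValue` stays open; nothing on crux stmt-ValiantsHypothesis-14610 or on `VP` versus `VNP`.
-/

set_option linter.dupNamespace false

namespace Summit.ValiantsHypothesis.ValiantsHypothesis.Theorems.BarrierLever.MoorePeel

open Polynomial Finset

/-! ## 1. The generic Dirichlet stage matrix -/

/-- The stage-`i` matrix of the Dirichlet(α,α) peel with SYMBOLIC parameter `α = X`:
`G^{(X)}_i[j,m] = [T_j ⊆ T_{c_i+m}] · X(X+1)⋯(X+k-1)`, `k = |T_{c_i+m}| - |T_j|` (rising factorial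
`ascPochhammer ℤ k`).  At a natural parameter `α` it evaluates to `kpeelMatrix (Nat.ascFactorial α) i`
(`dirichletPeelPoly_eval`): `α = 1` is the factorial stage matrix `G_i` of the segment-mean peel, and the
top-degree form is the zeta window `Z_i` (`coeff_scaledDirichlet`). -/
noncomputable def dirichletPeelPoly (i : ℕ) : Matrix (Fin i) (Fin i) ℤ[X] :=
  Matrix.of fun j m => if bits (j : ℕ) ⊆ bits (windowStart i + (m : ℕ))
    then ascPochhammer ℤ ((bits (windowStart i + (m : ℕ))).card - (bits (j : ℕ)).card) else 0

/-- Entries of the generic Dirichlet stage matrix. -/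
theorem dirichletPeelPoly_apply (i : ℕ) (j m : Fin i) :
    dirichletPeelPoly i j m = if bits (j : ℕ) ⊆ bits (windowStart i + (m : ℕ))
      then ascPochhammer ℤ ((bits (windowStart i + (m : ℕ))).card - (bits (j : ℕ)).card) else 0 := rfl

/-- At a natural parameter `α` the generic matrix is the kernel stage matrix with the rising-factorial
weights `κ = Nat.ascFactorial α` (`α = 1`: factorials). -/
theorem dirichletPeelPoly_eval (α i : ℕ) :
    (dirichletPeelPoly i).map (Polynomial.eval (α : ℤ)) = kpeelMatrix (Nat.ascFactorial α) i := by
  ext j m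
  rw [Matrix.map_apply, dirichletPeelPoly_apply, kpeelMatrix_eq_kincl, kincl]
  split_ifs with hsub
  · rw [ascPochhammer_nat_eq_natCast_ascFactorial]
  · simp

/-- Hence `det G^{(α)}_i = (det G^{(X)}_i)(α)`. -/
theorem eval_det_dirichletPeelPoly (α i : ℕ) :
    (dirichletPeelPoly i).det.eval (α : ℤ) = (kpeelMatrix (Nat.ascFactorial α) i).det := by
  rw [← dirichletPeelPoly_eval, ← Polynomial.coe_evalRingHom, RingHom.map_det, RingHom.mapMatrix_apply]

/-- `α = 1`: the rising factorials `1·2⋯k = k!`, so `G^{(1)}_i = G_i` (`peelMatrix`). -/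
theorem kpeelMatrix_ascFactorial_one (i : ℕ) : kpeelMatrix (Nat.ascFactorial 1) i = peelMatrix i := by
  rw [← kpeelMatrix_factorial]
  congr 1
  funext k
  rw [Nat.one_ascFactorial]

/-! ## 2. The top-degree form is the zeta window: `det G^{(X)}_i ≠ 0` -/

/-- `|bits n| ≤ n`. -/
theorem card_bits_le (n : ℕ) : (bits n).card ≤ n := by
  calc (bits n).card ≤ (Finset.range n).card :=
        Finset.card_le_card fun c hc => Finset.mem_range.mpr (lt_of_mem_bits Nat.lt_two_pow_self hc)
    _ = n := Finset.card_range n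

section TopForm

variable (i : ℕ)

/-- Row exponents `q_j = |T_j|`, column exponents `p_m = |T_{c_i+m}|`, common bound `D = c_i + i`. -/
theorem card_bits_window_le (m : Fin i) : (bits (windowStart i + (m : ℕ))).card ≤ windowStart i + i :=
  (card_bits_le _).trans (by have := m.2; omega)

/-- The rescaled matrix `X^{|T_j|} · G^{(X)}_i[j,m] · X^{D - |T_{c_i+m}|}`. -/
noncomputable def scaledDirichlet : Matrix (Fin i) (Fin i) ℤ[X] :=
  Matrix.of fun j m => X ^ (bits (j : ℕ)).card * dirichletPeelPoly i j m *
    X ^ (windowStart i + i - (bits (windowStart i + (m : ℕ))).card)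

/-- The rescaled matrix is `diag(X^{q}) · G^{(X)}_i · diag(X^{D-p})`. -/
theorem scaledDirichlet_eq :
    scaledDirichlet i = Matrix.diagonal (fun j : Fin i => (X : ℤ[X]) ^ (bits (j : ℕ)).card) *
      dirichletPeelPoly i *
      Matrix.diagonal (fun m : Fin i => (X : ℤ[X]) ^ (windowStart i + i - (bits (windowStart i + (m : ℕ))).card)) := by
  ext j m
  rw [Matrix.mul_diagonal, Matrix.diagonal_mul, scaledDirichlet, Matrix.of_apply]

/-- Its determinant is a power of `X` times `det G^{(X)}_i`. -/
theorem det_scaledDirichlet :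
    (scaledDirichlet i).det = X ^ (∑ j : Fin i, (bits (j : ℕ)).card +
      ∑ m : Fin i, (windowStart i + i - (bits (windowStart i + (m : ℕ))).card)) * (dirichletPeelPoly i).det := by
  rw [scaledDirichlet_eq, Matrix.det_mul, Matrix.det_mul, Matrix.det_diagonal, Matrix.det_diagonal,
    Finset.prod_pow_eq_pow_sum, Finset.prod_pow_eq_pow_sum, pow_add]
  ring

/-- Every entry of the rescaled matrix has degree `≤ D`, … -/
theorem natDegree_scaledDirichlet_le (j m : Fin i) :
    (scaledDirichlet i j m).natDegree ≤ windowStart i + i := by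
  rw [scaledDirichlet, Matrix.of_apply, dirichletPeelPoly_apply]
  split_ifs with hsub
  · have hq : (bits (j : ℕ)).card ≤ (bits (windowStart i + (m : ℕ))).card := Finset.card_le_card hsub
    have hp := card_bits_window_le i m
    have hmon : ((X : ℤ[X]) ^ (bits (j : ℕ)).card *
        ascPochhammer ℤ ((bits (windowStart i + (m : ℕ))).card - (bits (j : ℕ)).card) *
        X ^ (windowStart i + i - (bits (windowStart i + (m : ℕ))).card)).Monic :=
      ((monic_X_pow _).mul (monic_ascPochhammer ℤ _)).mul (monic_X_pow _)
    rw [((monic_X_pow _).mul (monic_ascPochhammer ℤ _)).natDegree_mul (monic_X_pow _),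
      (monic_X_pow _).natDegree_mul (monic_ascPochhammer ℤ _), natDegree_X_pow, natDegree_X_pow,
      ascPochhammer_natDegree]
    omega
  · simp

/-- … and its `X^D`-coefficient is the zeta entry `[T_j ⊆ T_{c_i+m}]`. -/
theorem coeff_scaledDirichlet (j m : Fin i) :
    (scaledDirichlet i j m).coeff (windowStart i + i) = zetaPeelMatrix i j m := by
  rw [scaledDirichlet, Matrix.of_apply, dirichletPeelPoly_apply, zetaPeelMatrix_apply]
  split_ifs with hsub
  · have hq : (bits (j : ℕ)).card ≤ (bits (windowStart i + (m : ℕ))).card := Finset.card_le_card hsub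
    have hp := card_bits_window_le i m
    have hmon : ((X : ℤ[X]) ^ (bits (j : ℕ)).card *
        ascPochhammer ℤ ((bits (windowStart i + (m : ℕ))).card - (bits (j : ℕ)).card) *
        X ^ (windowStart i + i - (bits (windowStart i + (m : ℕ))).card)).Monic :=
      ((monic_X_pow _).mul (monic_ascPochhammer ℤ _)).mul (monic_X_pow _)
    have hdeg : ((X : ℤ[X]) ^ (bits (j : ℕ)).card *
        ascPochhammer ℤ ((bits (windowStart i + (m : ℕ))).card - (bits (j : ℕ)).card) *
        X ^ (windowStart i + i - (bits (windowStart i + (m : ℕ))).card)).natDegree = windowStart i + i := by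
      rw [((monic_X_pow _).mul (monic_ascPochhammer ℤ _)).natDegree_mul (monic_X_pow _),
        (monic_X_pow _).natDegree_mul (monic_ascPochhammer ℤ _), natDegree_X_pow, natDegree_X_pow,
        ascPochhammer_natDegree]
      omega
    have hc := hmon.coeff_natDegree
    rw [hdeg] at hc
    exact hc
  · simp

/-- **The top-degree form of `det G^{(X)}_i` is `det Z_i`**: the coefficient of `X^{iD}` of the rescaled
determinant is the determinant of the zeta window. -/
theorem coeff_det_scaledDirichlet :
    (scaledDirichlet i).det.coeff (i * (windowStart i + i)) = (zetaPeelMatrix i).det := by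
  have := ChowBenchmarkPeel.coeff_det_of_natDegree_le (scaledDirichlet i) (windowStart i + i)
    (natDegree_scaledDirichlet_le i)
  rw [Fintype.card_fin] at this
  rw [this]
  congr 1
  ext j m
  rw [Matrix.of_apply, coeff_scaledDirichlet]

/-- **`det G^{(X)}_i ≠ 0` in `ℤ[X]` for EVERY `i`** (LEMMA Z′: its top form `det Z_i` is `±1`). -/
theorem det_dirichletPeelPoly_ne_zero : (dirichletPeelPoly i).det ≠ 0 := by
  intro h0
  have e := coeff_det_scaledDirichlet i
  rw [det_scaledDirichlet, h0, mul_zero, coeff_zero] at e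
  exact det_zetaPeelMatrix_ne_zero i e.symm

end TopForm

/-! ## 3. All but finitely many Dirichlet parameters are good at every height -/

/-- For each stage `i`, only finitely many natural parameters `α` have `det G^{(α)}_i = 0`. -/
theorem finite_bad_dirichlet (i : ℕ) :
    Set.Finite {α : ℕ | (kpeelMatrix (Nat.ascFactorial α) i).det = 0} := by
  have hfin := Polynomial.finite_setOf_isRoot (det_dirichletPeelPoly_ne_zero i)
  refine (hfin.preimage (Set.injOn_of_injective Nat.cast_injective)).subset ?_
  intro α hα
  simp only [Set.mem_preimage, Set.mem_setOf_eq, Polynomial.IsRoot.def, eval_det_dirichletPeelPoly]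
  exact hα

/-- **For every height `h`, all sufficiently large natural parameters `α` make EVERY Dirichlet stage matrix
`G^{(α)}_1, …, G^{(α)}_h` nonsingular** (while `α = 1`, the segment-mean peel, fails from `h = 183` on). -/
theorem eventually_det_dirichlet_ne_zero (h : ℕ) :
    ∃ α₀ : ℕ, ∀ α : ℕ, α₀ ≤ α → ∀ i : ℕ, 1 ≤ i → i ≤ h →
      (kpeelMatrix (Nat.ascFactorial α) i).det ≠ 0 := by
  have hfin : Set.Finite (⋃ i ∈ Finset.range (h + 1),
      {α : ℕ | (kpeelMatrix (Nat.ascFactorial α) i).det = 0}) :=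
    Set.Finite.biUnion (Finset.finite_toSet _) fun i _ => finite_bad_dirichlet i
  obtain ⟨α₀, hα₀⟩ := hfin.bddAbove
  refine ⟨α₀ + 1, fun α hα i _ hih h0 => ?_⟩
  have hmem : α ∈ ⋃ i ∈ Finset.range (h + 1), {α : ℕ | (kpeelMatrix (Nat.ascFactorial α) i).det = 0} :=
    Set.mem_biUnion (Finset.mem_coe.mpr (Finset.mem_range.mpr (Nat.lt_succ_of_le hih))) h0
  have := hα₀ hmem
  omega

/-! ## 4. Dirichlet(α,α) poisedness at every height for all large natural parameters -/

/-- Rising factorials with a positive base have no zero. -/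
theorem ascFactorial_ne_zero_of_pos {α : ℕ} (hα : 1 ≤ α) (k : ℕ) : Nat.ascFactorial α k ≠ 0 := by
  obtain ⟨β, rfl⟩ : ∃ β, α = β + 1 := ⟨α - 1, by omega⟩
  exact (Nat.ascFactorial_pos β k).ne'

/-- **TARGET (iii) of card v12 (E): for every height `h`, all sufficiently large natural parameters `α`
give Dirichlet(α,α) poisedness** — `KernelPoisedAt (Nat.ascFactorial α) h`, i.e. some point table makes the
matrix of Dirichlet(α,α)-weighted segment moments `[Σ_{g : T_j → u i} ∏_c P_{g c,c} ∏_a α^{(|g⁻¹ a|)}]` of the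
benchmark layout nonsingular (THEOREM A^κ with `κ = α^{(·)}`, whose stage matrices are nonsingular for
`α ≥ α₀(h)` by `eventually_det_dirichlet_ne_zero`).  The segment-mean stub of the line is the single
parameter `α = 1`, which this statement does not reach (`det G^{(1)}_{183} = 0`). -/
theorem eventually_kernelPoisedAt_dirichlet (h : ℕ) :
    ∃ α₀ : ℕ, ∀ α : ℕ, α₀ ≤ α → KernelPoisedAt (Nat.ascFactorial α) h := by
  obtain ⟨α₀, hα₀⟩ := eventually_det_dirichlet_ne_zero h
  refine ⟨α₀ + 1, fun α hα => ?_⟩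
  exact kernelPoisedAt_of_kpeel (Nat.ascFactorial α) (ascFactorial_ne_zero_of_pos (by omega)) h
    (hα₀ α (by omega))

/-- The generic statement behind it: for every `h` and every natural `α` OUTSIDE A FINITE SET, all Dirichlet
stage matrices `G^{(α)}_i`, `1 ≤ i ≤ h`, are nonsingular and `KernelPoisedAt (Nat.ascFactorial α) h` holds. -/
theorem kernelPoisedAt_dirichlet_off_finite (h : ℕ) :
    ∃ B : Finset ℕ, ∀ α : ℕ, α ∉ B → 1 ≤ α → KernelPoisedAt (Nat.ascFactorial α) h := by
  classical
  have hfin : Set.Finite (⋃ i ∈ Finset.range (h + 1),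
      {α : ℕ | (kpeelMatrix (Nat.ascFactorial α) i).det = 0}) :=
    Set.Finite.biUnion (Finset.finite_toSet _) fun i _ => finite_bad_dirichlet i
  refine ⟨hfin.toFinset, fun α hα h1 => ?_⟩
  apply kernelPoisedAt_of_kpeel (Nat.ascFactorial α) (ascFactorial_ne_zero_of_pos h1) h
  intro i _ hih h0
  apply hα
  rw [Set.Finite.mem_toFinset]
  exact Set.mem_biUnion (Finset.mem_coe.mpr (Finset.mem_range.mpr (Nat.lt_succ_of_le hih))) h0

/-- The parameter `α = 1` inside its certified window: the tree's kernel certificates `det G_i ≠ 0`, `i ≤ 52`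
(`…PartitionMinorsMooreBenchCert*`) give, through THEOREM A^κ, `KernelPoisedAt Nat.factorial h` — the line
file's `SegmentMeanValueAt h` verbatim — at every height `h ≤ 52`. -/
theorem kernelPoisedAt_factorial_of_le_52 (h : ℕ) (hh : h ≤ 52) : KernelPoisedAt Nat.factorial h :=
  kernelPoisedAt_factorial_of_peel h fun i hi hih => det_peelMatrix_ne_zero_of_le_52 i hi (hih.trans hh)

end Summit.ValiantsHypothesis.ValiantsHypothesis.Theorems.BarrierLever.MoorePeel
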